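import Mathlib
import HarnessLib
import HarnessLib.Audit
import Summits.Langlands.Statement
import Literature.NumberTheory.GaloisRepresentations.ResidualGaloisRep
import Literature.NumberTheory.Automorphic.ProModularDeRhamClassicalGL2Q
import Literature.NumberTheory.GaloisRepresentations.ResidualQuadraticField
import HarnessLib.Audit.Status.Attr

/-!
Route: DyadicOddResidue

DORMANT since 2026-08-25T14:46:53Z (reconciler: no traction for 7.8 d (last activity item-evidence-added at 2026-08-17T19:17:32Z); parked, not closed — `ledger route dormant route-Langlands-DyadicOddResidue --off` to reactivate) — unstaffed, not closed; items shared with open routes are served there. `ledger route dormant <id> --off` reactivates.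

# Route DyadicOddResidue — the dyadic residue of odd regular Fontaine–Mazur over ℚ — 2-adic Pan for
solvable residual image

OPEN-QUESTION HARVEST (lens oqh). After X. Zhang (arXiv:2412.06812, Dec 2024, abstract p.1: "we can
conclude the conjecture in the
regular case when p is an odd prime"; Thm 1.0.2 p.2 "Let p be an odd prime number …") and Tung
(Math. Z. 298, Thm 1 p.4: p = 2, ρ̄
NON-SOLVABLE image), clause (B) of the summit for n = 2, F = ℚ, ρ ODD with DISTINCT Hodge–Tate
weights (Target OddRegularReciprocityQ)
is PRINTED except at the single prime ℓ = 2 with SOLVABLE residual image, which in characteristic 2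
means ρ̄ reducible or ρ̄ dihedral
(Allen 2014 p.3). It suffices to show X = K1 ∧ K2: K1 (DyadicEisensteinFM) = the printed question of
Paškūnas–Tung (Forum Math. Sigma
9 (2021) e80, §1.2 p.6: "It seems likely that using the results of this paper, one can remove the
restriction on the prime p in Lue
Pan's work [37] on the Fontaine–Mazur conjecture in the residually reducible case … We hope to
return to these questions in future
work") — Fontaine–Mazur at ℓ = 2 for residually REDUCIBLE odd regular ρ; K2 (DyadicDihedralFM) = the
same for residually dihedral ρ
beyond Allen's nearly-ordinary theorem. The printed theorems enter as the supports
OddPrimesRegularFM and DyadicNonsolvableFM; the rest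
of the summit is the declared junction SectorComplement. No card is realised (none exists for this
sector).
Lean: `DyadicEisensteinFM ∧ DyadicDihedralFM`

## Assembly
Pure logic, certified in glue.lean (kernel-checked in Sketch.lean, rc 0): `closes (h₁ :
DyadicEisensteinFM) (h₂ : DyadicDihedralFM)
(h₃ : OddPrimesRegularFM) (h₄ : DyadicNonsolvableFM) (hC : SectorComplement) : Langlands := hC
(target)`, where the target is derived
inline by the trichotomy at a prime ℓ: `by_cases ℓ = 2` (else h₃); at ℓ = 2 `by_cases
ρ.IsResiduallyAbsIrreducible` (else h₁); then
`by_cases IsSolvable ρ.residualRep.range` (h₂, else h₄). Every hypothesis of closes is a declared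
item; the three crux binders (K1, K2,
junction) are all load-bearing. The Assembly item is the route's standing claim "the two dyadic
cruxes suffice" (the literal type of
closes is a propositional consequence of the implication-shaped supports and junction, so it is not
filed as the item).

Rationale: WHY THIS LINE. The most classical instance of reciprocity — odd two-dimensional regular ρ over ℚ —
has exactly one unprinted residue, and the literature
names its shape: Pan's proof (JAMS 35 (2022) Thms 1.0.2/1.0.4, "Let p be an odd prime") = big R^ps =
𝕋 by Taylor–Wiles patching of
completed homology at ONE-DIMENSIONAL primes (Skinner–Wiles) + Paškūnas's Bernstein-centre
description of the blocks of GL₂(ℚ_p) +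
classicality; the block theory at p = 2 now exists (PaskunasTung2021 Thms 1.1, 1.3, 7.1;
Paskunas2016), the classicality exit exists at
every p (Pan2022LocallyAnalyticII Thm 1.1.2: E/ℚ_p finite, ANY p, pro-modular + de Rham of weights 0
< k ⇒ classical), Tung2020 makes
every potentially semistable component of the framed deformation ring of ρ̄ on Γ_ℚ₂ automorphic, and
Allen2014 ran 2-adic Hida families
for dihedral ρ̄. What is genuinely left is characteristic-2 global deformation theory: oddness is
residually invisible (ρ̄(c) may be 1,
so the Skinner–Wiles / Bellaïche–Chenevier splitting of the pseudo-representation by ρ(c) =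
diag(1,−1) is unavailable mod 2), ω ≡ 1
(mod 2) makes every reducible block "exceptional", and Taylor–Wiles primes q ≡ 1 (mod 2^N) for
images induced from ℚ(i), ℚ(√±2) need
Allen's workaround. Imported areas: p-adic local Langlands for GL₂(ℚ₂) (Paškūnas,
Colmez–Dospinescu–Paškūnas), pseudo-representations
and determinants in characteristic 2 (Chenevier), 2-adic Hida theory. No listed route touches this
sector: SkinnerWilesDefectOne
(imaginary quadratic, p ≠ 2), EvenVoidBelowEight and EvenSkinnerWilesMirror (EVEN ρ, p ≠ 2),
ParityBlindBianchi (even Artin at 2 over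
a Bianchi field); the tree's own fact file FontaineMazurGL2OddPrime lists "p = 2 (Tung2020);
residually reducible … (Pan 2022)" as not
vendored; the negatives index (3 entries) is unrelated.

RANKED CRUXES. #0 OddRegularReciprocityQ (target) — clause (B) of the summit on the sector n = 2, F
= ℚ, ρ odd and Hodge–Tate regular, in the accepted almost-everywhere form: for every prime ℓ and
every continuous ρ : Γ_ℚ → GL₂(ℚ̄_ℓ) which is irreducible, odd, unramified at all but finitely many
places, and de Rham at the place above ℓ (pinned Fontaine datum) with multiplicity-free labelled
Hodge–Tate weights, and for every level witness and ι : ℚ̄_ℓ ≃ ℂ, there is an L-algebraic cuspidal π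
on GL₂(𝔸_ℚ) Satake–Frobenius compatible with ρ at almost all places (the Fontaine–Mazur conjecture
in the regular case, FontaineMazurGeometric1995, in the summit's own normalisation). (why it might
fail: Nobody expects an odd regular non-modular ρ over ℚ; the typed risks are the L-normalisation of
SatakeFrobCompatibleAt (same clause as the accepted ProModularOrdinaryClassical) and "up to twist"
in the printed theorems (absorbed by twisting π).) [FontaineMazurGeometric1995,
XZhang2024FontaineMazurP3, Tung2020, Pan2022, Kisin2009, BuzzardGeeLMS2014]
#2 DyadicEisensteinFM (crux) — PRINTED QUESTION (PaskunasTung2021 §1.2 p.6; Pan2022 Thm 1.0.2 "p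
odd"; XZhang2024FontaineMazurP3 Thm 1.0.2 "p odd"): the target at ℓ = 2 for ρ whose residual
representation is NOT absolutely irreducible — every continuous irreducible odd ρ : Γ_ℚ → GL₂(ℚ̄₂),
unramified almost everywhere, de Rham at 2 with distinct labelled Hodge–Tate weights, residually
reducible, is Satake–Frobenius compatible a.e. with an L-algebraic cuspidal π of GL₂(𝔸_ℚ). Intended
proof shape: 2-adic Skinner–Wiles (ρ reducible at 2) ∪ 2-adic Pan (ρ irreducible at 2) — big R^ps =
𝕋 at the Eisenstein maximal ideal mod 2 by patching completed homology at one-dimensional primes,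
Paškūnas–Tung's p = 2 blocks for local–global compatibility, Pan II's classicality for every p.
[difficulty: open-problem] (why it might fail: PaskunasTung2021 p.6 stop at "it seems likely": mod 2
oddness is invisible (ρ̄(c)=1 possible), so Skinner–Wiles's splitting by ρ(c) and Pan's 'nice
primes' fail; ω≡1 makes every reducible block exceptional (E_𝔅 uncomputed, loc. cit.); TW primes q≡1
mod 2^N need Kisin–KW 2-adic tricks.) [PaskunasTung2021, Pan2022, XZhang2024FontaineMazurP3,
Pan2022LocallyAnalyticII, SkinnerWiles1999, Kisin2009TwoAdic, KhareWintenberger2009,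
CalegariEmerton2005]
#3 DyadicDihedralFM (crux) — the target at ℓ = 2 for ρ whose residual representation is absolutely
irreducible with SOLVABLE image (= dihedral: Allen2014 p.3, "any absolutely irreducible,
2-dimensional, mod 2 representation with solvable image is dihedral") — PRINTED only when ρ is
nearly ordinary at 2 AND Allen's condition (5) holds (residual quadratic field L real, or 2 not
split in L: Allen2014 Theorem); OPEN for ρ absolutely irreducible at 2 (Paskunas2016 Thm 1.1 and
Tung2020 Thm 1 both print "non-solvable image") and for nearly ordinary ρ with L imaginary
quadratic, 2 split ("Hida's universal nearly ordinary Hecke algebra has CM components", Allen2014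
p.4). [difficulty: XL] (why it might fail: Allen2014 p.4: near-ordinarity "is essential to the
method as we use Hida families"; for ρ̄ induced from ℚ(i), ℚ(√±2) ⊂ ℚ(ζ₈) Taylor–Wiles primes q ≡ 1
mod 2^N with distinct ρ̄(Frob_q)-eigenvalues are scarce, and no 2-adic Breuil–Mézard for dihedral
blocks is in print.) [Allen2014, Paskunas2016, Tung2020, Kisin2009TwoAdic, KhareWintenberger2009,
Thorne2016]
#9 OddPrimesRegularFM (support) — PRINTED THEOREM typed fact-free (cite item to be filed): the
target for every ODD prime ℓ — XZhang2024FontaineMazurP3 Thm 1.0.2 (p odd; irreducible, finitely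
ramified, de Rham with distinct Hodge–Tate weights, odd ⇒ "arises from a cuspidal eigenform up to
twist"), assembling SkinnerWiles1999, Kisin2009, HuTan2015, Pan2022, Paskunas2015/Tung2021 (the
tree's `Tung2021_fontaineMazurGL2` is its ρ̄|ℚ(ζ_p)-irreducible part) and KhareWintenberger2009; the
prover converts "newform up to twist" into the L-algebraic cuspidal π with a.e. Satake matching
(dictionary of IsAutomorphicAE / HilbertModularGaloisRep; the twist is a cyclotomic power times a
finite character, absorbed into π). [difficulty: L] [XZhang2024FontaineMazurP3, Pan2022, Kisin2009,
HuTan2015, Tung2021, SkinnerWiles1999, KhareWintenberger2009]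
#9 DyadicNonsolvableFM (support) — PRINTED THEOREM typed fact-free (cite item to be filed): the
target at ℓ = 2 for ρ̄ absolutely irreducible with NON-solvable image — Tung2020 Thm 1 (p = 2:
distinct Hodge–Tate weights, ρ̄ modular, ρ̄ non-solvable image ⇒ ρ modular up to twist), with
residual modularity supplied by Serre's conjecture (KhareWintenberger2009, all p including 2;
oddness is vacuous mod 2) and the same newform → automorphic dictionary as OddPrimesRegularFM.
[difficulty: L] [Tung2020, KhareWintenberger2009, Kisin2009TwoAdic, Paskunas2016]
#9 SectorComplement (crux) — THE REST OF THE SUMMIT along this line — OddRegularReciprocityQ →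
Langlands with the target text INLINED (self-contained): clause (A) entirely, local–global
compatibility at every finite place, even ρ (void in regular weight: route EvenVoidBelowEight's
sector), equal Hodge–Tate weights (Artin / Maass λ = 1/4 sectors), n ≠ 2, F ≠ ℚ, the reciprocity
data 𝓡. Conjecture-grade, implied by the summit, never staffed from this route; filed so that
`closes` ends in the summit constant (sector convention of EvenVoidBelowEight /
RegularSerreAbelianSurfaces / AnalyticDescent). [difficulty: open-problem] (why it might fail: It IS
the open reciprocity conjecture for GL_n outside one sector (BuzzardGeeLMS2014 Conj. 3.2.1/3.2.2,
FontaineMazurGeometric1995 Conj. 1); no engine claimed; implied by the summit; graders judge the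
ranked cruxes.) [BuzzardGeeLMS2014, FontaineMazurGeometric1995, Calegari2023]

TWO-LAYER PLAN. Foreseen glued splits, none filed now (each is the BC3 birth skeleton, composition
proved, bc/*_birth.lean rc 0): (i) DyadicEisensteinFM
⇐ ReducibleAtTwo (ρ|Γ_ℚ₂ has a stable line: 2-adic Skinner–Wiles — Λ-adic nearly ordinary Hecke
algebra at an Eisenstein 𝔪 mod 2,
patching at one-dimensional primes, Pan's ordinary-case section transported) → IrreducibleAtTwo
(2-adic Pan: big R^ps = 𝕋 on completed
homology with the Paškūnas–Tung centre at p = 2, then Pan II Thm 1.1.2) → DyadicEisensteinFM. (ii)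
DyadicDihedralFM ⇐
DihedralNearlyOrdinary (Allen2014 when (5) holds; the CM-component case L imaginary, 2 split) →
DihedralIrreducibleAtTwo (supersingular
dihedral block at 2) → DyadicDihedralFM. (iii) Inside (i), later: ProModularityAtTwo (every such ρ
is 𝔭-adically automorphic for some
tame level, `TameLevel.IsPadicallyAutomorphic`, Emerton's pro-modularity) → ClassicalityAtTwo
(pro-modular + de Rham regular ⇒ classical:
Pan2022LocallyAnalyticII Thm 1.1.2 plus the occurrence step "ρ occurs in completed H¹" at an
Eisenstein 𝔪).

KILL CRITERIA. A proof in print of Fontaine–Mazur at p = 2 in the residually reducible (resp.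
dihedral non-ordinary) case closes DyadicEisensteinFM (resp.
DyadicDihedralFM) as a cite — the route then shrinks to the other crux or closes `superseded` (run
`lit citing` on PaskunasTung2021,
Pan2022, Tung2020, Allen2014 first). A refutation can only be (a) a MISSTATEMENT of the typed
clauses (normalisation of
SatakeFrobCompatibleAt, the pinned de Rham clause, `residualRep` junk) — repair by restating along
the accepted ProModularOrdinaryClassical
/ Tung2021_fontaineMazurGL2 renderings and re-certify; or (b) an odd, regular, a.e. unramified,
irreducible 2-adic ρ over ℚ that is
provably non-modular — that refutes the Fontaine–Mazur conjecture itself: close `refuted:<Decl>` and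
file the witness in BARRIERS.md.
If 2-adic Skinner–Wiles turns out to need ρ̄(c) ≠ 1 irreducibly, pivot K1 to the split "ρ̄(c) ≠ 1 /
ρ̄(c) = 1" with the second half
attacked through Calegari–Emerton-type Eisenstein presentations at p = 2 (CalegariEmerton2005).

NOT DECOMPOSED YET. The pro-modularity / classicality cut of K1 (layer 2, after the local-shape
split closes); the Taylor–Wiles-prime supply at p = 2 for
𝔽₂[[T]]-valued one-dimensional primes (a lemma under K1, to ride with --supports); Allen's condition
(5) as a typed predicate (needs the
residual quadratic field of a dihedral ρ̄ — definition request below); the newform → L-algebraic-π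
dictionary with twist absorption used by
both supports (shared with FontaineMazurGL2OddPrime consumers); the junction (never decomposed
here).

CHEAPEST FALSIFIER. (1) Literature, first: `lit citing doi:10.1017/fms.2021.72` (run 2026-08-17: 13
citers, none on p = 2 Fontaine–Mazur), `lit citing
doi:10.1090/jams/991` (46 citers: arXiv:2411.18661 and arXiv:2412.06812 push Pan to totally real
fields / p = 3, nothing at p = 2),
`lit citing doi:10.1007/s00209-020-02588-4` and Allen2014 (refuter should re-run through OpenAlex/S2
— APIs were rate-limited here).
(2) Consistency on the modular locus (refuter, pen and paper): ρ = ρ_Δ,2 (level 1, weight 12; ρ̄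
with trivial semisimplification) and ρ =
ρ_f,2 for f of level 11 and weight 2 (ρ̄ reducible) must satisfy every typed hypothesis of
DyadicEisensteinFM and its conclusion with π = a
twist of π_f — checks the L-normalisation and the pinned de Rham clause at 2. (3) `lean check` of
Sketch.lean (done, rc 0) and the BC2
probes (done, all fail as required).

NUMBERS. Residue bookkeeping: Fontaine–Mazur (GL₂/ℚ, odd, distinct HT weights) — p ≥ 5 complete
(Pan2022 Thm 1.0.4), p = 3 complete
(XZhang2024FontaineMazurP3 Thm 1.0.2, Dec 2024), p = 2: non-solvable ρ̄ (Tung2020 Thm 1), dihedral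
nearly ordinary with (5) (Allen2014);
open: reducible ρ̄, dihedral otherwise. Finite subgroups of PGL₂(𝔽̄₂): solvable irreducible ⇒
dihedral of order 2m, m odd (Allen2014
p.3). Local Euler characteristic at 2: dim H¹(G_ℚ₂, 𝔽₂(χ̄)) = 1 + 1 + dim H⁰ + dim H² ≥ 2 for every
χ̄ (vs 1 generically for p odd) —
the source of "every block is exceptional". Items at open: 7 (target, 3 cruxes incl. junction, 2
supports, assembly) ≤ 15.

DEFINITION REQUESTS. Cite facts wanted (filed after open as --kind cite):
`XZhang2024_fontaineMazurGL2_oddPrime` (XZhang2024FontaineMazurP3 Thm 1.0.2, in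
the rendering of `Tung2021_fontaineMazurGL2` without the ρ̄|ℚ(ζ_p) hypothesis) and
`Tung2020_fontaineMazurGL2_two` (Tung2020 Thm 1,
p = 2, non-solvable residual image), both in
Literature/NumberTheory/Automorphic/FontaineMazurGL2OddPrime's vocabulary; they discharge
the two supports together with the newform → automorphic dictionary. Notion wanted (optional,
sharpens K2): `residualQuadraticField`
of a dihedral-type ρ̄ : Γ_K → GL₂(k) (the unique quadratic L/K with ρ̄|Γ_L abelian), topic
Literature/NumberTheory/GaloisRepresentations,
to type Allen's condition (5).

Novelty: Searches (2026-08-17): corpus frontier.json (60 rows since 2023), reads.jsonl (5), galaxy.json (30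
books), new.md (37 works), nearmiss.md;
page-level reads: arXiv:2607.25889 pp.1–2,10,106; arXiv:2607.11763 pp.1–8; arXiv:2605.03519 chunks
1–4; arXiv:2603.18961 (grep 35 hits);
arXiv:2602.16452 chunks 2–3; arXiv:2407.00288 pp.1–8; arXiv:2209.06366 pp.1–6 (+grep all);
arXiv:1901.07166 pp.3–4;
doi:10.1017/fms.2021.72 pp.1–2,6,31; arXiv:2411.18661 pp.1–3; arXiv:2412.06812 pp.1–4;
arXiv:1908.06174 pp.3–4; arXiv:1301.1113 pp.3–4;
doi:10.2140/ant.2016.10.1301 pp.3–5; `lit citing doi:10.1017/fms.2021.72` (13, api), `lit citing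
doi:10.1090/jams/991` (46, local graph);
`lit search --source crossref` "Fontaine-Mazur conjecture residually reducible 2-adic" (8),
"Paskunas Tung finiteness …" (8), "Paskunas
2-dimensional 2-adic …" (6); `lit search --source arxiv` "Xinyao Zhang Fontaine-Mazur p=3" (1); `lit
galaxy search` ×3 (0 hits; 2026
papers not in the internal corpora); OpenAlex/S2/zbMATH rate-limited (429) — refuter should re-run;
`lean search` (Tung2021_fontaineMazurGL2,
IsPadicallyAutomorphic, IsResiduallyAbsIrreducible, IsDihedralType, IsOdd,
exists_isComplexConjugation); `ledger negatives --problem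
Langlands` (3, unrelated); the 84 route files of the sub (grep p = 2 / Skinner / Pan / Paškūnas) and
the 29 idea cards.
Nearest prior art found: PaskunasTung2021 §1.2 p.6 (the printed hope itself, unrealised: "It seems
likely that … one can remove the
restriction on the prime p in Lue Pan'  [refs: 10.1017/fms.2021.72, 10.2140/ant.2016.10.1301, 10.1017/fms.2021.72`, 10.1090/jams/991`, 2607.25889, 2607.11763, 2605.03519, 2603.18961, 2602.16452, 2407.00288, 2209.06366, 1901.07166, 2411.18661, 2412.06812, 1908.06174, 1301.1113, doi:10.1017/fms.2021.72, doi:10.2140/ant.2016.10.1301, doi:10.1090/jams/991, PaskunasTung2021, Allen2014, Tung2020]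

Barriers (technique_class: pro-modularity, completed-cohomology patching, 2-adic): - technique_class: pro-modularity, completed-cohomology patching, 2-adic
- Literature.Barriers.Langlands.ResiduallyReducibleBarrier: engaged head-on by K1 (ρ̄ reducible) —
evaded as in its printed evasions (Skinner–Wiles / Pan): no Taylor–Wiles system is run at ρ̄;
patching happens at one-dimensional primes 𝔭 of R^ps (characteristic 0 or 𝔽[[T]]) where ρ(𝔭) is
irreducible and Mazur's condition holds, and the reducible locus is pushed to large codimension by
base change.
- Literature.Barriers.Langlands.ResiduallyReducibleBarrierNarrow: its own remark bites at ℓ = 2: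
H⁰(ad⁰ ρ̄) ≠ 0 for EVERY 2-dimensional ρ̄ in characteristic 2 (tr 1 = 0), so no adequacy-based
lifting theorem applies to any ρ̄ here; the bet is that Pan's method needs Mazur/adequacy only at
the one-dimensional prime, where 2 is invertible (char-0 primes) or the image is pro-2-free enough
(Kisin–KW 2-adic TW primes).
- Literature.Barriers.Langlands.SolvableImageBarrier: K2 is literally the solvable (dihedral) image;
the barrier's blocked technique (solvable base change / Langlands–Tunnell) is not used — K2 is to be
won 2-adically (Allen-style Hida families at nearly ordinary ρ); for the supersingular dihedral
block it does not evade anything in print; the bet is a 2-adic Breuil–Mézard / "every component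
automorphic" statement for dihedral ρ̄ extending Tung2020 Cor 4.4, with Thorne2016-type level
raising at a Steinberg prime to restore TW-prime supply.
- Literature.Barriers.Langlands.SolvableImageBarrierNarrow: not

Novelty grade: variant — route-review (refuter rreview-0817T02-14): VARIANT — the load-bearing mechanism (Pan's pseudo-deformation R^ps = T patching at one-dimensional primes + Paškūnas(-Tung) block theory + Pan II classicality, as the thesis itself says: '2-adic Pan for solvable residual image') is the mechanism ALREADY US (refuter refuter-rreview-0817T02-14-0, 2026-08-17T04:08:14Z; prior: arXiv:2412.06812, doi:10.1090/jams/991, doi:10.1017/fms.2021.72, doi:10.1007/s00209-020-02627-5, arXiv:1301.1113)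

History (route lifecycle, newest last):
- 2026-08-25T14:46:53Z · DORMANT — reconciler: no traction for 7.8 d (last activity item-evidence-added at 2026-08-17T19:17:32Z); parked, not closed — `ledger route dormant route-Langlands-Dyadic (operator:999:2434686)

sub-problem: Langlands · status: dormant · opened planner-plan-lens3-Langlands-oqh-g2-0 2026-08-17T02:58:08Z · rev 6 · ledger route-Langlands-DyadicOddResidue
GENERATED by the gate from the ledger (D-0016/17). Provers cite these decls: `theorem foo : Summit.Langlands.Langlands.Theses.DyadicOddResidue.<Decl> := …` in Summits/Langlands/Langlands/Theorems/<Name>.lean.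
-/

namespace Summit.Langlands.Langlands.Theses.DyadicOddResidue

open scoped BigOperators Topology Manifold Classical MeasureTheory ProbabilityTheory Matrix InnerProductSpace ComplexConjugate ContinuousMap
open Filter Set Function TopologicalSpace MeasureTheory

attribute [summit_statement] _root_.Langlands

/-- item stmt-Langlands-18740 · target · rank 0 · open · by planner
why it might fail: Nobody expects an odd regular non-modular ρ over ℚ; the typed risks are the L-normalisation of SatakeFrobCompatibleAt (same clause as the accepted ProModularOrdinaryClassical) and "up to twist" in the printed theorems (absorbed by twisting π).
sources: FontaineMazurGeometric1995, XZhang2024FontaineMazurP3, Tung2020, Pan2022, Kisin2009, BuzzardGeeLMS2014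
[target] clause (B) of the summit on the sector n = 2, F = ℚ, ρ odd and Hodge–Tate regular, in the
accepted almost-everywhere form: for every prime ℓ and every continuous ρ : Γ_ℚ → GL₂(ℚ̄_ℓ) which is
irreducible, odd, unramified at all but finitely many places, and de Rham at the place above ℓ
(pinned Fontaine datum) with multiplicity-free labelled Hodge–Tate weights, and for every level
witness and ι : ℚ̄_ℓ ≃ ℂ, there is an L-algebraic cuspidal π on GL₂(𝔸_ℚ) Satake–Frobenius compatible
with ρ at almost all places (the Fontaine–Mazur conjecture in the regular case,
FontaineMazurGeometric1995, in the summit's own normalisation). -/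
@[route_item "route-Langlands-DyadicOddResidue"]
def OddRegularReciprocityQ : Prop :=
  ∀ (ℓ : ℕ) [Fact ℓ.Prime] (ρ : Literature.NumberTheory.GaloisRepresentations.FramedGaloisRep ℚ (PadicAlgCl ℓ) 2), ρ.toGaloisRep.IsIrreducible → ρ.IsOdd → (∀ᶠ v : IsDedekindDomain.HeightOneSpectrum (NumberField.RingOfIntegers ℚ) in Filter.cofinite, ρ.IsUnramifiedAt v) → (∀ (v : IsDedekindDomain.HeightOneSpectrum (NumberField.RingOfIntegers ℚ)) (hv : ((ℓ : ℕ) : NumberField.RingOfIntegers ℚ) ∈ v.asIdeal), (Literature.NumberTheory.PAdicHodge.fontainePstAdicCompletion v ℓ hv).IsDeRhamFramed (ρ.toLocal v) ∧ ∀ τ : v.adicCompletion ℚ →+* PadicAlgCl ℓ, Continuous τ → (ρ.labelledHodgeTateWeightsAt v (Literature.NumberTheory.PAdicHodge.fontainePstAdicCompletion v ℓ hv).algebra (Literature.NumberTheory.PAdicHodge.fontainePstAdicCompletion v ℓ hv).𝔅 τ).Nodup) → ∀ (hcpt : Literature.NumberTheory.Automorphic.isCompact_glFiniteIntegralLevel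 2 ℚ) (ι : PadicAlgCl ℓ ≃+* ℂ), ∃ π : Literature.NumberTheory.Automorphic.CuspidalAutomorphicRepData 2 ℚ hcpt, π.1.IsLAlgebraic ∧ ∀ᶠ v : IsDedekindDomain.HeightOneSpectrum (NumberField.RingOfIntegers ℚ) in Filter.cofinite, Summit.Langlands.SatakeFrobCompatibleAt ι π.1 ρ v

/-- item stmt-Langlands-18741 · crux · rank 2 · open · by planner
why it might fail: PaskunasTung2021 p.6 stop at "it seems likely": mod 2 oddness is invisible (ρ̄(c)=1 possible), so Skinner–Wiles's splitting by ρ(c) and Pan's 'nice primes' fail; ω≡1 makes every reducible block exceptional (E_𝔅 uncomputed, loc. cit.); TW primes q≡1 mod 2^N need Kisin–KW 2-adic tricks.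
sources: PaskunasTung2021, Pan2022, XZhang2024FontaineMazurP3, Pan2022LocallyAnalyticII, SkinnerWiles1999, Kisin2009TwoAdic
[crux] PRINTED QUESTION (PaskunasTung2021 §1.2 p.6; Pan2022 Thm 1.0.2 "p odd";
XZhang2024FontaineMazurP3 Thm 1.0.2 "p odd"): the target at ℓ = 2 for ρ whose residual
representation is NOT absolutely irreducible — every continuous irreducible odd ρ : Γ_ℚ → GL₂(ℚ̄₂),
unramified almost everywhere, de Rham at 2 with distinct labelled Hodge–Tate weights, residually
reducible, is Satake–Frobenius compatible a.e. with an L-algebraic cuspidal π of GL₂(𝔸_ℚ). Intended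
proof shape: 2-adic Skinner–Wiles (ρ reducible at 2) ∪ 2-adic Pan (ρ irreducible at 2) — big R^ps =
𝕋 at the Eisenstein maximal ideal mod 2 by patching completed homology at one-dimensional primes,
Paškūnas–Tung's p = 2 blocks for local–global compatibility, Pan II's classicality for every p.
[difficulty: open-problem] -/
@[route_item "route-Langlands-DyadicOddResidue", crux]
def DyadicEisensteinFM : Prop :=
  ∀ (ℓ : ℕ) [Fact ℓ.Prime], ℓ = 2 → ∀ (ρ : Literature.NumberTheory.GaloisRepresentations.FramedGaloisRep ℚ (PadicAlgCl ℓ) 2), ¬ ρ.IsResiduallyAbsIrreducible → ρ.toGaloisRep.IsIrreducible → ρ.IsOdd → (∀ᶠ v : IsDedekindDomain.HeightOneSpectrum (NumberField.RingOfIntegers ℚ) in Filter.cofinite, ρ.IsUnramifiedAt v) → (∀ (v : IsDedekindDomain.HeightOneSpectrum (NumberField.RingOfIntegers ℚ)) (hv : ((ℓ : ℕ) : NumberField.RingOfIntegers ℚ) ∈ v.asIdeal), (Literature.NumberTheory.PAdicHodge.fontainePstAdicCompletion v ℓ hv).IsDeRhamFramed (ρ.toLocal v) ∧ ∀ τ :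 v.adicCompletion ℚ →+* PadicAlgCl ℓ, Continuous τ → (ρ.labelledHodgeTateWeightsAt v (Literature.NumberTheory.PAdicHodge.fontainePstAdicCompletion v ℓ hv).algebra (Literature.NumberTheory.PAdicHodge.fontainePstAdicCompletion v ℓ hv).𝔅 τ).Nodup) → ∀ (hcpt : Literature.NumberTheory.Automorphic.isCompact_glFiniteIntegralLevel 2 ℚ) (ι : PadicAlgCl ℓ ≃+* ℂ), ∃ π : Literature.NumberTheory.Automorphic.CuspidalAutomorphicRepData 2 ℚ hcpt, π.1.IsLAlgebraic ∧ ∀ᶠ v : IsDedekindDomain.HeightOneSpectrum (NumberField.RingOfIntegers ℚ) in Filter.cofinite, Summit.Langlands.SatakeFrobCompatibleAt ι π.1 ρ v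

/-- item stmt-Langlands-18168 · crux · rank 3 · open · by planner
why it might fail: Not in print off the Thorne/Allen cells (lead census c1): for ρ̄ induced from ℚ(i), ℚ(√±2) TW primes q≡1 mod 2^N are scarce, Hida's nearly ordinary algebra has CM components (Allen2014 p.4), no 2-adic infinite-fern density / Breuil–Mézard for dihedral blocks exists.
sources: Allen2014, Thorne2026FontaineMazurGL2, Paskunas2016, Tung2020, Kisin2009TwoAdic, KhareWintenberger2009
[crux] child 3a of DyadicDihedralFM (K2) — the OPEN CORE of the dihedral cell, VERBATIM the
registered stub `stub_proModularity_core` of the lead's skeleton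
Cruxes/DyadicDihedralFM/Lines/Sketch.lean (rev 3, a3541bed): every odd, residually dihedral
(absolutely irreducible with solvable image), irreducible, a.e. unramified ρ : Γ_ℚ → GL₂(ℚ̄₂), de
Rham at 2 with distinct labelled Hodge–Tate weights, lying OFF the two printed cells — no Tate twist
of ρ is potentially crystalline Skinner–Wiles-ordinary of weight 2 at 2 (Thorne 2026 Thm D), and
Allen's cell fails (condition (5) false, or no Tate twist nearly ordinary of weight ≥ 2 with
finite-order det·ε₂^{1−k}; Allen 2014) — is 2-adically automorphic of some tame level
(`BigHeckeGLn.TameLevel.IsPadicallyAutomorphic`, the tree's 'pro-modular', as in the accepted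
ProModularOrdinaryClassical). On paper the domain is ρ|G_ℚ₂ irreducible (the supersingular dihedral
block, all weights) ∪ (ρ|G_ℚ₂ reducible, residual quadratic field imaginary with 2 split, outside
the pot.-crystalline consecutive-weight case). NOT IN PRINT (Kisin2009TwoAdic /
KhareWintenberger2009 / Paskunas2016 / Tung2020 all exclude solvable residual image; the infinite
fern a -/
@[route_item "route-Langlands-DyadicOddResidue", crux]
def DihedralProModularityCore : Prop :=
  ∀ (ρ : Literature.NumberTheory.GaloisRepresentations.FramedGaloisRep ℚ (PadicAlgCl 2) 2), ρ.IsResiduallyAbsIrreducible → IsSolvable ρ.residualRep.range → ρ.toGaloisRep.IsIrreducible → ρ.IsOdd → (∀ᶠ v : IsDedekindDomain.HeightOneSpectrum (NumberField.RingOfIntegers ℚ) in Filter.cofinite, ρ.IsUnramifiedAt v) → (∀ (v : IsDedekindDomain.HeightOneSpectrum (NumberField.RingOfIntegers ℚ)) (hv : ((2 : ℕ) : NumberField.RingOfIntegers ℚ) ∈ v.asIdeal), (Literature.NumberTheory.PAdicHodge.fontainePstAdicCompletion v 2 hv).IsDeRhamFramed (ρ.toLocal v) ∧ ∀ τ : v.adicCompletion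 ℚ →+* PadicAlgCl 2, Continuous τ → (ρ.labelledHodgeTateWeightsAt v (Literature.NumberTheory.PAdicHodge.fontainePstAdicCompletion v 2 hv).algebra (Literature.NumberTheory.PAdicHodge.fontainePstAdicCompletion v 2 hv).𝔅 τ).Nodup) → ¬ (∃ (χ₀ : Field.absoluteGaloisGroup ℚ →ₜ* (PadicAlgCl 2)ˣ) (a : ℤ) (m : ℕ), (∀ σ, χ₀ σ = Literature.NumberTheory.GaloisRepresentations.cyclotomicPadicAlgCl ℚ 2 σ ^ a) ∧ 0 < m ∧ ∀ (v : IsDedekindDomain.HeightOneSpectrum (NumberField.RingOfIntegers ℚ)) (hv : ((2 : ℕ) : NumberField.RingOfIntegers ℚ) ∈ v.asIdeal), Literature.NumberTheory.GaloisRepresentations.FramedGaloisRep.IsOrdinaryOfWeightAt 2 (Literature.NumberTheory.GaloisRepresentations.FramedRep.twist ρ χ₀) v 2 m ∧ (Literature.NumberTheory.PAdicHodge.fontainePstAdicCompletion v 2 hv).IsDeRhamFramed (Literature.NumberTheory.GaloisRepresentations.FramedGaloisRep.toLocal v (Literature.NumberTheory.GaloisRepresentations.FramedRep.twist ρ χ₀))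 ∧ ∀ r, (Literature.NumberTheory.PAdicHodge.fontainePstAdicCompletion v 2 hv).IsWeilDeligneOf (Literature.NumberTheory.GaloisRepresentations.FramedGaloisRep.toLocal v (Literature.NumberTheory.GaloisRepresentations.FramedRep.twist ρ χ₀)) r → r.N = 0) → ¬ (Literature.NumberTheory.GaloisRepresentations.AllenConditionFive ρ.residualRep ∧ ∃ (χ₀ : Field.absoluteGaloisGroup ℚ →ₜ* (PadicAlgCl 2)ˣ) (a : ℤ) (k m : ℕ), (∀ σ, χ₀ σ = Literature.NumberTheory.GaloisRepresentations.cyclotomicPadicAlgCl ℚ 2 σ ^ a) ∧ 2 ≤ k ∧ 0 < m ∧ (∀ v : IsDedekindDomain.HeightOneSpectrum (NumberField.RingOfIntegers ℚ), ((2 : ℕ) : NumberField.RingOfIntegers ℚ) ∈ v.asIdeal → Literature.NumberTheory.GaloisRepresentations.FramedGaloisRep.IsOrdinaryOfWeightAt 2 (Literature.NumberTheory.GaloisRepresentations.FramedRep.twist ρ χ₀) v k m) ∧ ∃ n : ℕ, 0 < n ∧ ∀ σ, (Literature.NumberTheory.GaloisRepresentations.FramedRep.det (Literature.NumberTheory.GaloisRepresentations.FramedRep.twist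 ρ χ₀) σ * (Literature.NumberTheory.GaloisRepresentations.cyclotomicPadicAlgCl ℚ 2 σ ^ ((k : ℤ) - 1))⁻¹) ^ n = 1) → ∃ 𝒰 : Literature.NumberTheory.Automorphic.BigHeckeGLn.TameLevel 2 ℚ 2, 𝒰.IsPadicallyAutomorphic ρ

/-- item stmt-Langlands-18742 · crux · rank 3 · open · by planner
why it might fail: Allen2014 p.4: near-ordinarity "is essential to the method as we use Hida families"; for ρ̄ induced from ℚ(i), ℚ(√±2) ⊂ ℚ(ζ₈) Taylor–Wiles primes q ≡ 1 mod 2^N with distinct ρ̄(Frob_q)-eigenvalues are scarce, and no 2-adic Breuil–Mézard for dihedral blocks is in print.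
sources: Allen2014, Paskunas2016, Tung2020, Kisin2009TwoAdic, KhareWintenberger2009, Thorne2016
[crux] the target at ℓ = 2 for ρ whose residual representation is absolutely irreducible with
SOLVABLE image (= dihedral: Allen2014 p.3, "any absolutely irreducible, 2-dimensional, mod 2
representation with solvable image is dihedral") — PRINTED only when ρ is nearly ordinary at 2 AND
Allen's condition (5) holds (residual quadratic field L real, or 2 not split in L: Allen2014
Theorem); OPEN for ρ absolutely irreducible at 2 (Paskunas2016 Thm 1.1 and Tung2020 Thm 1 both print
"non-solvable image") and for nearly ordinary ρ with L imaginary quadratic, 2 split ("Hida's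
universal nearly ordinary Hecke algebra has CM components", Allen2014 p.4). [difficulty: XL] -/
@[route_item "route-Langlands-DyadicOddResidue", crux]
def DyadicDihedralFM : Prop :=
  ∀ (ℓ : ℕ) [Fact ℓ.Prime], ℓ = 2 → ∀ (ρ : Literature.NumberTheory.GaloisRepresentations.FramedGaloisRep ℚ (PadicAlgCl ℓ) 2), ρ.IsResiduallyAbsIrreducible → IsSolvable ρ.residualRep.range → ρ.toGaloisRep.IsIrreducible → ρ.IsOdd → (∀ᶠ v : IsDedekindDomain.HeightOneSpectrum (NumberField.RingOfIntegers ℚ) in Filter.cofinite, ρ.IsUnramifiedAt v) → (∀ (v : IsDedekindDomain.HeightOneSpectrum (NumberField.RingOfIntegers ℚ)) (hv : ((ℓ : ℕ) : NumberField.RingOfIntegers ℚ) ∈ v.asIdeal), (Literature.NumberTheory.PAdicHodge.fontainePstAdicCompletion v ℓ hv).IsDeRhamFramed (ρ.toLocal v) ∧ ∀ τ : v.adicCompletion ℚ →+* PadicAlgCl ℓ, Continuous τ → (ρ.labelledHodgeTateWeightsAt v (Literature.NumberTheory.PAdicHodge.fontainePstAdicCompletion v ℓ hv).algebra (Literature.NumberTheory.PAdicHodge.fontainePstAdicCompletion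 v ℓ hv).𝔅 τ).Nodup) → ∀ (hcpt : Literature.NumberTheory.Automorphic.isCompact_glFiniteIntegralLevel 2 ℚ) (ι : PadicAlgCl ℓ ≃+* ℂ), ∃ π : Literature.NumberTheory.Automorphic.CuspidalAutomorphicRepData 2 ℚ hcpt, π.1.IsLAlgebraic ∧ ∀ᶠ v : IsDedekindDomain.HeightOneSpectrum (NumberField.RingOfIntegers ℚ) in Filter.cofinite, Summit.Langlands.SatakeFrobCompatibleAt ι π.1 ρ v

/-- item stmt-Langlands-18102 · crux · rank 4 · open · by planner
why it might fail: Printed theorem; the risk is the rendering: tree 'p-adically automorphic' = point of the ALL-degree Hecke algebra of Scholze's X_U, matched to Pan's degree-1 T(K^p) only at non-Eisenstein m; Qbar_p vs E coefficients (Baire), Cor 6.3.6 + PT 7.1 at p=2 and the newform glue (c) are unprinted steps.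
sources: Pan2022LocallyAnalyticII, Pan2022LocallyAnalytic, PaskunasTung2021, Emerton2011LocalGlobal, CalegariEmerton2011, Scholze2015
[crux] PROMOTED NAMED FACT — Pan II classicality for GL₂/ℚ at EVERY prime p (the route uses p = 2).
Statement = the Literature decl
`Literature.NumberTheory.Automorphic.Pan2022_proModularDeRhamClassical_GL2Q` VERBATIM (alias): every
continuous ρ : Γ_ℚ → GL₂(ℚ̄_p) which is residually absolutely irreducible, irreducible, unramified
almost everywhere, de Rham at p (pinned Fontaine datum) with distinct labelled Hodge–Tate weights,
and p-adically automorphic of some tame level (`BigHeckeGLn.TameLevel.IsPadicallyAutomorphic`: a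
continuous ℚ̄_p-point of the completed-cohomology Hecke algebra — Emerton's 'promodular', Pan's Def.
6.1.2) has a Tate twist ρ ⊗ ε_p^m attached to a newform f ∈ S_k(Γ₁(N)) away from N·p
(`IsGaloisRepOfNewform1`). Printed: Pan, arXiv:2209.06366 Thm 1.1.2 = Thm 7.1.2 ("Fix a prime number
p"), with Pan, Forum Math. Pi 10 (2022) Def. 6.1.2 / Cor. 6.3.6 (pro-modular + irreducible ⇒
pro-cohomological), unconditional in p by Paškūnas–Tung 2021 Thm 7.1, plus the rendering glue
(a)–(c) recorded in the fact's module docstring. ROUTE-CHOICE REPAIR 2026-08-17 (unit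
rchoice-…-646ffb05): the fact is XL-apex (no single literature seat can discharge it; non-crux facts
are not spl -/
@[route_item "route-Langlands-DyadicOddResidue", crux]
def ProModularClassicality : Prop :=
  ∀ (p : ℕ) [Fact p.Prime] (ρ : Literature.NumberTheory.GaloisRepresentations.FramedGaloisRep ℚ (PadicAlgCl p) 2), ρ.IsResiduallyAbsIrreducible → ρ.toGaloisRep.IsIrreducible → (∀ᶠ v : IsDedekindDomain.HeightOneSpectrum (NumberField.RingOfIntegers ℚ) in Filter.cofinite, ρ.IsUnramifiedAt v) → (∀ (v : IsDedekindDomain.HeightOneSpectrum (NumberField.RingOfIntegers ℚ)) (hv : ((p : ℕ) : NumberField.RingOfIntegers ℚ) ∈ v.asIdeal), (Literature.NumberTheory.PAdicHodge.fontainePstAdicCompletion v p hv).IsDeRhamFramed (ρ.toLocal v) ∧ ∀ τ : v.adicCompletion ℚ →+* PadicAlgCl p, Continuous τ → (ρ.labelledHodgeTateWeightsAt v (Literature.NumberTheory.PAdicHodge.fontainePstAdicCompletion v p hv).algebra (Literature.NumberTheory.PAdicHodge.fontainePstAdicCompletion v p hv).𝔅 τ).Nodup) → (∃ 𝒰 :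 Literature.NumberTheory.Automorphic.BigHeckeGLn.TameLevel 2 ℚ p, 𝒰.IsPadicallyAutomorphic ρ) → ∃ (χ : Field.absoluteGaloisGroup ℚ →ₜ* (PadicAlgCl p)ˣ) (m : ℤ), (∀ σ, χ σ = Literature.NumberTheory.GaloisRepresentations.cyclotomicPadicAlgCl ℚ p σ ^ m) ∧ ∃ (N : ℕ) (_ : NeZero N) (k : ℤ) (f : CuspForm (CongruenceSubgroup.Gamma1 N) k) (ιf : Literature.NumberTheory.EllipticCurves.ModularForms.coeffCharField f →+* PadicAlgCl p), Literature.NumberTheory.EllipticCurves.ModularForms.IsNewform1 f ∧ Literature.NumberTheory.EllipticCurves.ModularForms.IsGaloisRepOfNewform1 f ιf {q | q ∣ N * p} (Literature.NumberTheory.GaloisRepresentations.FramedRep.twist ρ χ)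

/-- item stmt-Langlands-18743 · crux · rank 9 · open · by planner
why it might fail: Printed only as Pan 2022 Thm 1.0.4 (refereed; at p=3 needs a local proviso) + X. Zhang arXiv:2412.06812 Thm 1.0.2 (Dec 2024 preprint removing it); rendering risks: L-algebraic/Tate-twist normalisation in SatakeFrobCompatibleAt, pinned D_pst de Rham clause, Nodup on continuous labels.
sources: XZhang2024FontaineMazurP3, Pan2022, SkinnerWiles1999, Kisin2009, HuTan2015, Tung2021
[support] PRINTED THEOREM typed fact-free (cite item to be filed): the target for every ODD prime ℓ
— XZhang2024FontaineMazurP3 Thm 1.0.2 (p odd; irreducible, finitely ramified, de Rham with distinct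
Hodge–Tate weights, odd ⇒ "arises from a cuspidal eigenform up to twist"), assembling
SkinnerWiles1999, Kisin2009, HuTan2015, Pan2022, Paskunas2015/Tung2021 (the tree's
`Tung2021_fontaineMazurGL2` is its ρ̄|ℚ(ζ_p)-irreducible part) and KhareWintenberger2009; the prover
converts "newform up to twist" into the L-algebraic cuspidal π with a.e. Satake matching (dictionary
of IsAutomorphicAE / HilbertModularGaloisRep; the twist is a cyclotomic power times a finite
character, absorbed into π). [difficulty: L] -/
@[route_item "route-Langlands-DyadicOddResidue", crux]
def OddPrimesRegularFM : Prop :=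
  ∀ (ℓ : ℕ) [Fact ℓ.Prime], ℓ ≠ 2 → ∀ (ρ : Literature.NumberTheory.GaloisRepresentations.FramedGaloisRep ℚ (PadicAlgCl ℓ) 2), ρ.toGaloisRep.IsIrreducible → ρ.IsOdd → (∀ᶠ v : IsDedekindDomain.HeightOneSpectrum (NumberField.RingOfIntegers ℚ) in Filter.cofinite, ρ.IsUnramifiedAt v) → (∀ (v : IsDedekindDomain.HeightOneSpectrum (NumberField.RingOfIntegers ℚ)) (hv : ((ℓ : ℕ) : NumberField.RingOfIntegers ℚ) ∈ v.asIdeal), (Literature.NumberTheory.PAdicHodge.fontainePstAdicCompletion v ℓ hv).IsDeRhamFramed (ρ.toLocal v) ∧ ∀ τ : v.adicCompletion ℚ →+* PadicAlgCl ℓ, Continuous τ → (ρ.labelledHodgeTateWeightsAt v (Literature.NumberTheory.PAdicHodge.fontainePstAdicCompletion v ℓ hv).algebra (Literature.NumberTheory.PAdicHodge.fontainePstAdicCompletion v ℓ hv).𝔅 τ).Nodup) → ∀ (hcpt : Literature.NumberTheory.Automorphic.isCompact_glFiniteIntegralLevel 2 ℚ) (ι : PadicAlgCl ℓ ≃+*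 ℂ), ∃ π : Literature.NumberTheory.Automorphic.CuspidalAutomorphicRepData 2 ℚ hcpt, π.1.IsLAlgebraic ∧ ∀ᶠ v : IsDedekindDomain.HeightOneSpectrum (NumberField.RingOfIntegers ℚ) in Filter.cofinite, Summit.Langlands.SatakeFrobCompatibleAt ι π.1 ρ v

/-- item stmt-Langlands-18744 · crux (kind.auto-crux: conjecture-grade) · rank 9 · open · by planner
why it might fail: auto-crux — conjecture-grade statement (docstring avows it ('conjecture')); it is open, so it may simply be false
sources: Tung2020, KhareWintenberger2009, Kisin2009TwoAdic, Paskunas2016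
[support] PRINTED THEOREM typed fact-free (cite item to be filed): the target at ℓ = 2 for ρ̄
absolutely irreducible with NON-solvable image — Tung2020 Thm 1 (p = 2: distinct Hodge–Tate weights,
ρ̄ modular, ρ̄ non-solvable image ⇒ ρ modular up to twist), with residual modularity supplied by
Serre's conjecture (KhareWintenberger2009, all p including 2; oddness is vacuous mod 2) and the same
newform → automorphic dictionary as OddPrimesRegularFM. [difficulty: L] -/
@[route_item "route-Langlands-DyadicOddResidue", crux]
def DyadicNonsolvableFM : Prop :=
  ∀ (ℓ : ℕ) [Fact ℓ.Prime], ℓ = 2 → ∀ (ρ : Literature.NumberTheory.GaloisRepresentations.FramedGaloisRep ℚ (PadicAlgCl ℓ) 2), ρ.IsResiduallyAbsIrreducible → ¬ IsSolvable ρ.residualRep.range → ρ.toGaloisRep.IsIrreducible → ρ.IsOdd → (∀ᶠ v : IsDedekindDomain.HeightOneSpectrum (NumberField.RingOfIntegers ℚ) in Filter.cofinite, ρ.IsUnramifiedAt v) → (∀ (v : IsDedekindDomain.HeightOneSpectrum (NumberField.RingOfIntegers ℚ)) (hv : ((ℓ : ℕ) : NumberField.RingOfIntegers ℚ) ∈ v.asIdeal),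 (Literature.NumberTheory.PAdicHodge.fontainePstAdicCompletion v ℓ hv).IsDeRhamFramed (ρ.toLocal v) ∧ ∀ τ : v.adicCompletion ℚ →+* PadicAlgCl ℓ, Continuous τ → (ρ.labelledHodgeTateWeightsAt v (Literature.NumberTheory.PAdicHodge.fontainePstAdicCompletion v ℓ hv).algebra (Literature.NumberTheory.PAdicHodge.fontainePstAdicCompletion v ℓ hv).𝔅 τ).Nodup) → ∀ (hcpt : Literature.NumberTheory.Automorphic.isCompact_glFiniteIntegralLevel 2 ℚ) (ι : PadicAlgCl ℓ ≃+* ℂ), ∃ π : Literature.NumberTheory.Automorphic.CuspidalAutomorphicRepData 2 ℚ hcpt, π.1.IsLAlgebraic ∧ ∀ᶠ v : IsDedekindDomain.HeightOneSpectrum (NumberField.RingOfIntegers ℚ) in Filter.cofinite, Summit.Langlands.SatakeFrobCompatibleAt ι π.1 ρ v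

/-- item stmt-Langlands-18745 · crux · rank 9 · open · by planner
why it might fail: It IS the open reciprocity conjecture for GL_n outside one sector (BuzzardGeeLMS2014 Conj. 3.2.1/3.2.2, FontaineMazurGeometric1995 Conj. 1); no engine claimed; implied by the summit; graders judge the ranked cruxes.
sources: BuzzardGeeLMS2014, FontaineMazurGeometric1995, Calegari2023
[crux] THE REST OF THE SUMMIT along this line — OddRegularReciprocityQ → Langlands with the target
text INLINED (self-contained): clause (A) entirely, local–global compatibility at every finite
place, even ρ (void in regular weight: route EvenVoidBelowEight's sector), equal Hodge–Tate weights
(Artin / Maass λ = 1/4 sectors), n ≠ 2, F ≠ ℚ, the reciprocity data 𝓡. Conjecture-grade, implied by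
the summit, never staffed from this route; filed so that `closes` ends in the summit constant
(sector convention of EvenVoidBelowEight / RegularSerreAbelianSurfaces / AnalyticDescent).
[difficulty: open-problem] -/
@[route_item "route-Langlands-DyadicOddResidue", crux]
def SectorComplement : Prop :=
  (∀ (ℓ : ℕ) [Fact ℓ.Prime] (ρ : Literature.NumberTheory.GaloisRepresentations.FramedGaloisRep ℚ (PadicAlgCl ℓ) 2), ρ.toGaloisRep.IsIrreducible → ρ.IsOdd → (∀ᶠ v : IsDedekindDomain.HeightOneSpectrum (NumberField.RingOfIntegers ℚ) in Filter.cofinite, ρ.IsUnramifiedAt v) → (∀ (v : IsDedekindDomain.HeightOneSpectrum (NumberField.RingOfIntegers ℚ)) (hv : ((ℓ : ℕ) : NumberField.RingOfIntegers ℚ) ∈ v.asIdeal), (Literature.NumberTheory.PAdicHodge.fontainePstAdicCompletion v ℓ hv).IsDeRhamFramed (ρ.toLocal v) ∧ ∀ τ : v.adicCompletion ℚ →+* PadicAlgCl ℓ, Continuous τ → (ρ.labelledHodgeTateWeightsAt v (Literature.NumberTheory.PAdicHodge.fontainePstAdicCompletion v ℓ hv).algebra (Literature.NumberTheory.PAdicHodge.fontainePstAdicCompletion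 v ℓ hv).𝔅 τ).Nodup) → ∀ (hcpt : Literature.NumberTheory.Automorphic.isCompact_glFiniteIntegralLevel 2 ℚ) (ι : PadicAlgCl ℓ ≃+* ℂ), ∃ π : Literature.NumberTheory.Automorphic.CuspidalAutomorphicRepData 2 ℚ hcpt, π.1.IsLAlgebraic ∧ ∀ᶠ v : IsDedekindDomain.HeightOneSpectrum (NumberField.RingOfIntegers ℚ) in Filter.cofinite, Summit.Langlands.SatakeFrobCompatibleAt ι π.1 ρ v) → _root_.Langlands

/-- item stmt-Langlands-18103 · support · rank 9 · open · by planner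
[support] THE TWO PRINTED DIHEDRAL CELLS at ℓ = 2, typed fact-free (route convention; VERBATIM the
hypotheses at p = 2 of the accepted named facts Thorne2026_fontaineMazurGL2_potCrystallineOrdinary
(p149703) and Allen2014_modularity_nearlyOrdinaryDihedral_Q (p150207), from which it follows in two
lines — planner Sketch.lean `dyadicDihedralPrintedCellsFM_of_facts`, = cellThorne_newform /
cellAllen_newform of Cruxes/DyadicDihedralFM/Lines/Sketch.lean): for ρ as in the dihedral crux, if
some Tate twist is weight-2 ordinary, de Rham and potentially crystalline at 2 (Thorne 2026 Thm D,
any residual image) OR Allen's condition (5) holds and some Tate twist is nearly ordinary of weight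
k ≥ 2 with finite-order det·ε₂^{1-k} (Allen 2014), then some Tate twist of ρ is attached to a
newform away from 2N. PRINTED THEOREMS (XL to formalise; literature debt, not a crux). [difficulty:
XL] -/
@[route_item "route-Langlands-DyadicOddResidue", crux]
def DyadicDihedralPrintedCellsFM : Prop :=
  ∀ (ρ : Literature.NumberTheory.GaloisRepresentations.FramedGaloisRep ℚ (PadicAlgCl 2) 2), ρ.IsResiduallyAbsIrreducible → IsSolvable ρ.residualRep.range → ρ.toGaloisRep.IsIrreducible → ρ.IsOdd → (∀ᶠ v : IsDedekindDomain.HeightOneSpectrum (NumberField.RingOfIntegers ℚ) in Filter.cofinite, ρ.IsUnramifiedAt v) → (∀ (v : IsDedekindDomain.HeightOneSpectrum (NumberField.RingOfIntegers ℚ)) (hv : ((2 : ℕ) : NumberField.RingOfIntegers ℚ) ∈ v.asIdeal), (Literature.NumberTheory.PAdicHodge.fontainePstAdicCompletion v 2 hv).IsDeRhamFramed (ρ.toLocal v) ∧ ∀ τ : v.adicCompletion ℚ →+* PadicAlgCl 2, Continuous τ → (ρ.labelledHodgeTateWeightsAt v (Literature.NumberTheory.PAdicHodge.fontainePstAdicCompletion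 v 2 hv).algebra (Literature.NumberTheory.PAdicHodge.fontainePstAdicCompletion v 2 hv).𝔅 τ).Nodup) → (∃ (χ₀ : Field.absoluteGaloisGroup ℚ →ₜ* (PadicAlgCl 2)ˣ) (a : ℤ) (m : ℕ), (∀ σ, χ₀ σ = Literature.NumberTheory.GaloisRepresentations.cyclotomicPadicAlgCl ℚ 2 σ ^ a) ∧ 0 < m ∧ ∀ (v : IsDedekindDomain.HeightOneSpectrum (NumberField.RingOfIntegers ℚ)) (hv : ((2 : ℕ) : NumberField.RingOfIntegers ℚ) ∈ v.asIdeal), Literature.NumberTheory.GaloisRepresentations.FramedGaloisRep.IsOrdinaryOfWeightAt 2 (Literature.NumberTheory.GaloisRepresentations.FramedRep.twist ρ χ₀) v 2 m ∧ (Literature.NumberTheory.PAdicHodge.fontainePstAdicCompletion v 2 hv).IsDeRhamFramed (Literature.NumberTheory.GaloisRepresentations.FramedGaloisRep.toLocal v (Literature.NumberTheory.GaloisRepresentations.FramedRep.twist ρ χ₀)) ∧ ∀ r, (Literature.NumberTheory.PAdicHodge.fontainePstAdicCompletion v 2 hv).IsWeilDeligneOf (Literature.NumberTheory.GaloisRepresentations.FramedGaloisRep.toLocal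 v (Literature.NumberTheory.GaloisRepresentations.FramedRep.twist ρ χ₀)) r → r.N = 0) ∨ (Literature.NumberTheory.GaloisRepresentations.AllenConditionFive ρ.residualRep ∧ ∃ (χ₀ : Field.absoluteGaloisGroup ℚ →ₜ* (PadicAlgCl 2)ˣ) (a : ℤ) (k m : ℕ), (∀ σ, χ₀ σ = Literature.NumberTheory.GaloisRepresentations.cyclotomicPadicAlgCl ℚ 2 σ ^ a) ∧ 2 ≤ k ∧ 0 < m ∧ (∀ v : IsDedekindDomain.HeightOneSpectrum (NumberField.RingOfIntegers ℚ), ((2 : ℕ) : NumberField.RingOfIntegers ℚ) ∈ v.asIdeal → Literature.NumberTheory.GaloisRepresentations.FramedGaloisRep.IsOrdinaryOfWeightAt 2 (Literature.NumberTheory.GaloisRepresentations.FramedRep.twist ρ χ₀) v k m) ∧ ∃ n : ℕ, 0 < n ∧ ∀ σ, (Literature.NumberTheory.GaloisRepresentations.FramedRep.det (Literature.NumberTheory.GaloisRepresentations.FramedRep.twist ρ χ₀) σ * (Literature.NumberTheory.GaloisRepresentations.cyclotomicPadicAlgCl ℚ 2 σ ^ ((k : ℤ) - 1))⁻¹) ^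 n = 1) → ∃ (χ : Field.absoluteGaloisGroup ℚ →ₜ* (PadicAlgCl 2)ˣ) (m : ℤ), (∀ σ, χ σ = Literature.NumberTheory.GaloisRepresentations.cyclotomicPadicAlgCl ℚ 2 σ ^ m) ∧ ∃ (N : ℕ) (_ : NeZero N) (k : ℤ) (f : CuspForm (CongruenceSubgroup.Gamma1 N) k) (ιf : Literature.NumberTheory.EllipticCurves.ModularForms.coeffCharField f →+* PadicAlgCl 2), Literature.NumberTheory.EllipticCurves.ModularForms.IsNewform1 f ∧ Literature.NumberTheory.EllipticCurves.ModularForms.IsGaloisRepOfNewform1 f ιf {q | q ∣ N * 2} (Literature.NumberTheory.GaloisRepresentations.FramedRep.twist ρ χ)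

/-- item stmt-Langlands-18169 · support · rank 9 · closed · proved by Summit.Langlands.Langlands.Theorems.DyadicDihedralFMGlue_proof @ 4026924c9984 (prover) · by planner
sources: Pan2022LocallyAnalyticII, Thorne2026FontaineMazurGL2, Allen2014
[glue] the cell split of DyadicDihedralFM (K2): open core 3a (DihedralProModularityCore: 2-adic
pro-modularity off the printed cells) → Pan II classicality for GL₂/ℚ at every prime, used at p = 2
(ProModularClassicality, stmt-Langlands-18102) → the two printed dihedral cells
(DyadicDihedralPrintedCellsFM, stmt-Langlands-18103) → DyadicDihedralFM. PROVABLE NOW, pure logic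
over two LANDED theorems: at ℓ = 2 case on the printed cells; on a cell,
`Summit.Langlands.Langlands.Theorems.DyadicDihedralFM.stub_dictionary` (p145281) turns the
Tate-twist newform into the L-algebraic cuspidal π with a.e. Satake matching; off both cells the
core gives pro-modularity, `Summit.Langlands.Langlands.Theorems.DyadicDihedralFM.stub_classicality`
(p148844) applied to ProModularClassicality (rfl-equal to the fact
Pan2022_proModularDeRhamClassical_GL2Q) gives the Tate-twist newform, then the dictionary again.
Kernel-checked by the planner (folder Scratch.lean, `dyadicDihedralFMGlue_holds`, lean check rc 0, 0
sorries, axioms propext/Classical.choice/Quot.sound) — it is `DyadicDihedralFM_of` of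
Cruxes/DyadicDihedralFM/Lines/Sketch.lean with its four stubs turned into hypotheses. [deps:
DihedralProModularity -/
@[route_item "route-Langlands-DyadicOddResidue", crux]
def DyadicDihedralFMGlue : Prop :=
  DihedralProModularityCore → ProModularClassicality → DyadicDihedralPrintedCellsFM → DyadicDihedralFM

/-- item stmt-Langlands-18746 · assembly · rank 1 · open · by planner
sources: PaskunasTung2021, XZhang2024FontaineMazurP3, Tung2020, BuzzardGeeLMS2014
[assembly] DyadicEisensteinFM → DyadicDihedralFM → Langlands (given the printed supports and the
junction). -/
@[route_item "route-Langlands-DyadicOddResidue"]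
def Assembly : Prop :=
  DyadicEisensteinFM → DyadicDihedralFM → _root_.Langlands

/-! D-0027 §2.1 — DECIDING THEOREM (planner-authored via `route open/edit --closes-file`; by planner-rrepair-Langlands-DyadicOddResidue-unu-52ddaa9b-0 2026-08-17T12:28:44Z):
its hypotheses are this route's items and its conclusion the sub-problem Statement (glue_lint), and it elaborates with this file. -/

@[closes "route-Langlands-DyadicOddResidue"] theorem closes (h₁ : DyadicEisensteinFM) (h₂a : DihedralProModularityCore) (h₂b : ProModularClassicality)
    (h₂c : DyadicDihedralPrintedCellsFM) (h₂g : DyadicDihedralFMGlue) (h₃ : OddPrimesRegularFM)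
    (h₄ : DyadicNonsolvableFM) (hC : SectorComplement) : _root_.Langlands := by
  -- the target (clause (B) on the sector n = 2, F = ℚ, odd, regular) from the four Fontaine–Mazur
  -- cells, by the trichotomy at ℓ: ℓ ≠ 2 / ℓ = 2 residually reducible / dihedral / non-solvable
  have hT : DyadicEisensteinFM → DyadicDihedralFM → OddRegularReciprocityQ := by
    intro k₁ k₂ ℓ _ ρ hirr hodd hunr hdR hcpt ι
    by_cases hℓ : ℓ = 2
    · by_cases hres : ρ.IsResiduallyAbsIrreducible
      · by_cases hsol : IsSolvable ρ.residualRep.range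
        · exact k₂ ℓ hℓ ρ hres hsol hirr hodd hunr hdR hcpt ι
        · exact h₄ ℓ hℓ ρ hres hsol hirr hodd hunr hdR hcpt ι
      · exact k₁ ℓ hℓ ρ hres hirr hodd hunr hdR hcpt ι
    · exact h₃ ℓ hℓ ρ hirr hodd hunr hdR hcpt ι
  -- the route's Assembly claim (K1 → K2 → summit) from the junction, then K2 from its three cells
  -- (open core 3a, Pan II classicality at 2, the two printed dihedral cells) through the split glue
  have hA : Assembly := fun k₁ k₂ => hC (hT k₁ k₂)
  exact hA h₁ (h₂g h₂a h₂b h₂c)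

end Summit.Langlands.Langlands.Theses.DyadicOddResidue
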